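import Summits.RiemannHypothesis.RiemannHypothesis.Theorems.SoninPolyTraceEval
import HarnessLib

/-!
# The twisted Sonin trace form of a polynomial section vector, IV: the interval loop and its inclusion theorem

Cell `rh-explicit`, seat cc-s2-1 (sub-line (ii), S = {∞, 2}).  With the primitives of part III: the per-`z` enclosure
`coreI ∋ I(z)` (`mem_coreI`, from the ODE facts `antiderivOK` and `log 2 ≤ 2b`), the running powers `ZState`
(`e^{±(2k+1)b}`, `e^{±(2k+1)L/2}` as products — only six `exp` enclosures are ever computed, in part V), the main loop
`loopB` over `k` (`z = ±(2k+1)`) on the integer antiderivative tables `SPtab`/`SNtab`, with every new interval FORCED to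
literals (`forceInt`, `forceMI`: matching an integer down to its `Nat` literal makes the kernel evaluate it at once), the
table check `antiderivsOK`, and the loop inclusion theorem `mem_loopB`
(`Σ_{j<k+fuel} WN_j I(−(2j+1))`, `Σ WP_i I(2i+1)` ∈ the two accumulators).  Part V (`SoninPolyTraceCheck`) adds the inputs,
the chunked driver and the certified bound `Blo ≤ Re soninTraceForm (twistKernel 2 (G⋆G̃)) (polyEta r X)`.
Definitions (`EvalParams`, `ZState`, `coreI`, `forceInt`, `forceMI`, `loopB`, `SPtab`, `SNtab`, `antiderivsOK`, `ZInv`) are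
certificate bookkeeping; no facts, no axioms.
-/

set_option linter.dupNamespace false  -- the mandated namespace repeats `RiemannHypothesis`

noncomputable section

open MeasureTheory Set Finset
open scoped Real
open Summit.RiemannHypothesis.RiemannHypothesis.Theorems.SemilocalPolyWitness
open Summit.RiemannHypothesis.RiemannHypothesis.SoninCert (derivL)
open Literature.NumberTheory.LFunctions Literature.NumberTheory.ConnesConsani2021
open Literature.Analysis.ValidatedNumerics Literature.Analysis.ValidatedNumerics.NumericsMP

namespace Summit.RiemannHypothesis.RiemannHypothesis.SoninPoly

/-! ## The evaluator -/

/-- Engine parameters: fixed-point scale `S`, `exp` Taylor order `Ke` and halvings `ke`, `log 2` series order `Kl`.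
[folklore] -/
structure EvalParams where
  /-- fixed-point scale -/
  S : ℕ
  /-- Taylor order of the `exp` enclosures -/
  Ke : ℕ
  /-- argument halvings of the `exp` enclosures -/
  ke : ℕ
  /-- series order of the `log 2` enclosure -/
  Kl : ℕ

/-- The running powers for the odd exponent `z = 2k+1`: enclosures of `e^{zb}`, `e^{−zb}`, `e^{zL/2}`, `e^{−zL/2}`. [folklore] -/
structure ZState where
  /-- `∋ e^{(2k+1)b}` -/
  P : MI
  /-- `∋ e^{−(2k+1)b}` -/
  M : MI
  /-- `∋ e^{(2k+1)L/2}` -/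
  Sq : MI
  /-- `∋ e^{−(2k+1)L/2}` -/
  T : MI

/-- One step `k ↦ k+1` of the running powers (`·e^{2b}`, `·e^{−2b}`, `·2`, `/2`). [folklore] -/
def ZState.step (S : ℕ) (E2 E2m : MI) (st : ZState) : ZState :=
  ⟨MI.mul S st.P E2, MI.mul S st.M E2m, st.Sq.mulInt 2, st.T.divNat 2⟩

/-- **Enclosure of `I(z)`** from enclosures `eh ∋ e^{−L/2}`, `ezL ∋ e^{zL/2}`, `emzL ∋ e^{−zL/2}`, `ezb ∋ e^{zb}` and of the
polynomial VALUES `vz1 ∋ Q_z(2b)`, `vz0 ∋ Q_z(0)`, `vzL ∋ Q_z(L)`, `vmL ∋ Q_{−z}(L)`, `vm0 ∋ Q_{−z}(0)`: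
`I(z) = 3J₀ − 2e^{−L/2}(e^{zL/2}J₀ + e^{zL/2}J_L + e^{−zL/2}J_R)`, `J₀ = e^{zb}Q_z(2b) − Q_z(0)`,
`J_L = e^{−zL/2}Q_{−z}(L) − Q_{−z}(0)`, `J_R = e^{zb}Q_z(2b) − e^{zL/2}Q_z(L)`. [folklore] -/
def coreI (S : ℕ) (eh ezL emzL ezb vz1 vz0 vzL vmL vm0 : MI) : MI :=
  let q2b := MI.mul S ezb vz1
  let J0 := q2b.sub vz0
  let JL := (MI.mul S emzL vmL).sub vm0
  let JR := q2b.sub (MI.mul S ezL vzL)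
  let inner := ((MI.mul S ezL J0).add (MI.mul S ezL JL)).add (MI.mul S emzL JR)
  (J0.mulInt 3).sub ((MI.mul S eh inner).mulInt 2)

variable (b : ℚ) (r : List ℚ) (X : ℚ) (κL : List ℚ)

/-- Forcing gadget, CPS style: matching an integer down to its `Nat` literal makes the KERNEL evaluate it NOW and hand the
continuation a small literal term (instead of a growing unevaluated expression).  Value: `forceInt i cont = cont i`. [folklore] -/
def forceInt {β : Type} (i : ℤ) (cont : ℤ → β) : β :=
  match i with
  | Int.ofNat n => (match n with | 0 => cont (Int.ofNat 0) | k + 1 => cont (Int.ofNat (k + 1)))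
  | Int.negSucc n => (match n with | 0 => cont (Int.negSucc 0) | k + 1 => cont (Int.negSucc (k + 1)))

/-- `forceInt i cont = cont i`. [folklore] -/
theorem forceInt_eq {β : Type} (i : ℤ) (cont : ℤ → β) : forceInt i cont = cont i := by
  unfold forceInt
  rcases i with n | n <;> cases n <;> rfl

/-- Forcing an interval (both endpoints). [folklore] -/
def forceMI {β : Type} (I : MI) (cont : MI → β) : β :=
  forceInt I.lo fun lo => forceInt I.hi fun hi => cont ⟨lo, hi⟩

/-- `forceMI I cont = cont I`. [folklore] -/
theorem forceMI_eq {β : Type} (I : MI) (cont : MI → β) : forceMI I cont = cont I := by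
  unfold forceMI; rw [forceInt_eq, forceInt_eq]

/-! ## The loop -/

/-- The main loop over `k = k₀, k₀+1, …` (`fuel` steps), consuming the integer antiderivative tables for `z = 2k+1`,
`z = −(2k+1)` head-first: accumulates `Σ WN_k·I(−(2k+1))` and `Σ WP_k·I(2k+1)` while updating the running powers; the
values `Q_{±(2k+1)}(2b)`, `Q_{±(2k+1)}(0)` are exact rationals and `Q_{±(2k+1)}(L)` an integer Horner value (`valL`,
`val2b`, `val0`), and every new interval is FORCED to literals (see `forceMI`) so that the kernel's lazy evaluation
stays flat. Returns the two accumulators. [folklore] -/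
def loopB (S : ℕ) (Λ eh E2 E2m : MI) : ℕ → ℕ → List (List ℤ) → List (List ℤ) → ZState → MI → MI → MI × MI
  | 0, _, _, _, _, aN, aP => (aN, aP)
  | _ + 1, _, [], _, _, aN, aP => (aN, aP)
  | _ + 1, _, _ :: _, [], _, aN, aP => (aN, aP)
  | fuel + 1, k, sp :: SPs, sn :: SNs, st, aN, aP =>
    let z : ℤ := 2 * (k : ℤ) + 1
    let vpL := valL κL S Λ sp z
    let vnL := valL κL S Λ sn (-z)
    let Ip := coreI S eh st.Sq st.T st.P (val2b κL b S sp z) (val0 κL S sp z) vpL vnL (val0 κL S sn (-z))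
    let In := coreI S eh st.T st.Sq st.M (val2b κL b S sn (-z)) (val0 κL S sn (-z)) vnL vpL (val0 κL S sp z)
    let st' := st.step S E2 E2m
    let aN' := aN.add (MI.mul S In (wnMI r X S k))
    let aP' := aP.add (MI.mul S Ip (wpMI r S k))
    forceMI st'.P fun P => forceMI st'.M fun M => forceMI st'.Sq fun Sq => forceMI st'.T fun T =>
      forceMI aN' fun aN'' => forceMI aP' fun aP'' =>
        loopB S Λ eh E2 E2m fuel (k + 1) SPs SNs ⟨P, M, Sq, T⟩ aN'' aP''

/-- Table of the integer lists `s` for `z = 2k+1`, `k = k₀, …, k₀ + n − 1`. [folklore] -/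
def SPtab (κL : List ℚ) (k₀ : ℕ) : ℕ → List (List ℤ)
  | 0 => []
  | n + 1 => sList κL (2 * (k₀ : ℤ) + 1) :: SPtab κL (k₀ + 1) n

/-- Table of the integer lists `s` for `z = −(2k+1)`, `k = k₀, …, k₀ + n − 1`. [folklore] -/
def SNtab (κL : List ℚ) (k₀ : ℕ) : ℕ → List (List ℤ)
  | 0 => []
  | n + 1 => sList κL (-(2 * (k₀ : ℤ) + 1)) :: SNtab κL (k₀ + 1) n

/-- All certificate antiderivatives (computed by `antiderivQ`) pass their ODE checks. [folklore] -/
def antiderivsOK (n : ℕ) (κL : List ℚ) : Bool :=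
  (List.range n).all fun k =>
    antiderivOK κL (2 * (k : ℤ) + 1) (antiderivQ κL (2 * (k : ℤ) + 1))
      && antiderivOK κL (-(2 * (k : ℤ) + 1)) (antiderivQ κL (-(2 * (k : ℤ) + 1)))


/-! ## Soundness -/

variable {b r X κL}

/-- **Soundness of `coreI`**: with the ODE facts for `Q_z`, `Q_{−z}`, `log 2 ≤ 2b` and memberships of the inputs,
`I(z) ∈ coreI …`. [folklore] -/
theorem mem_coreI {S : ℕ} (hS : 0 < S) {eh ezL emzL ezb vz1 vz0 vzL vmL vm0 : MI}
    (heh : MI.mem S (Real.exp (-(Real.log 2 / 2))) eh) {z : ℤ} (hezL : MI.mem S (expq z (Real.log 2)) ezL)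
    (hemzL : MI.mem S (expq (-z) (Real.log 2)) emzL) (hezb : MI.mem S (expq z (2 * (b : ℝ))) ezb)
    (hL : Real.log 2 ≤ 2 * (b : ℝ)) {Qz Qm : List ℚ}
    (hQz : antiderivOK κL z Qz = true) (hQm : antiderivOK κL (-z) Qm = true)
    (hvz1 : MI.mem S (LQ.ev Qz (2 * (b : ℝ))) vz1) (hvz0 : MI.mem S (LQ.ev Qz 0) vz0)
    (hvzL : MI.mem S (LQ.ev Qz (Real.log 2)) vzL) (hvmL : MI.mem S (LQ.ev Qm (Real.log 2)) vmL)
    (hvm0 : MI.mem S (LQ.ev Qm 0) vm0) :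
    MI.mem S (Iint κL b z) (coreI S eh ezL emzL ezb vz1 vz0 vzL vmL vm0) := by
  rw [Iint_eq κL hL z, Jint_eq_of_antiderivOK hQz, Jint_eq_of_antiderivOK hQm, Jint_eq_of_antiderivOK hQz]
  have e0 : expq z 0 = 1 := by unfold expq; simp
  have e0' : expq (-z) 0 = 1 := by unfold expq; simp
  rw [e0, e0', one_mul, one_mul]
  have mq2b := MI.mem_mul hS hezb hvz1
  have mJ0 := MI.mem_sub mq2b hvz0
  have mJL := MI.mem_sub (MI.mem_mul hS hemzL hvmL) hvm0
  have mJR := MI.mem_sub mq2b (MI.mem_mul hS hezL hvzL)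
  have minner := MI.mem_add (MI.mem_add (MI.mem_mul hS hezL mJ0) (MI.mem_mul hS hezL mJL)) (MI.mem_mul hS hemzL mJR)
  have mtot := MI.mem_sub (MI.mem_mulInt mJ0 3) (MI.mem_mulInt (MI.mem_mul hS heh minner) 2)
  unfold coreI
  convert mtot using 1
  push_cast
  ring

/-- The antiderivative table, unpacked. [folklore] -/
theorem antiderivsOK_spec {n : ℕ} (h : antiderivsOK n κL = true) {k : ℕ} (hk : k < n) :
    antiderivOK κL (2 * (k : ℤ) + 1) (antiderivQ κL (2 * (k : ℤ) + 1)) = true ∧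
      antiderivOK κL (-(2 * (k : ℤ) + 1)) (antiderivQ κL (-(2 * (k : ℤ) + 1))) = true := by
  unfold antiderivsOK at h
  rw [List.all_eq_true] at h
  have := h k (List.mem_range.2 hk)
  simpa [Bool.and_eq_true] using this

/-- The loop invariant: running powers at index `k`. [folklore] -/
structure ZInv (S : ℕ) (b : ℚ) (k : ℕ) (st : ZState) : Prop where
  /-- `e^{(2k+1)b} ∈ P` -/
  hP : MI.mem S (Real.exp ((2 * (k : ℝ) + 1) * b)) st.P
  /-- `e^{−(2k+1)b} ∈ M` -/
  hM : MI.mem S (Real.exp (-((2 * (k : ℝ) + 1) * b))) st.M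
  /-- `e^{(2k+1)L/2} ∈ Sq` -/
  hSq : MI.mem S (Real.exp ((2 * (k : ℝ) + 1) * Real.log 2 / 2)) st.Sq
  /-- `e^{−(2k+1)L/2} ∈ T` -/
  hT : MI.mem S (Real.exp (-((2 * (k : ℝ) + 1) * Real.log 2 / 2))) st.T

/-- The invariant is preserved by `ZState.step`. [folklore] -/
theorem ZInv.step {S : ℕ} (hS : 0 < S) {k : ℕ} {st : ZState} (h : ZInv S b k st) {E2 E2m : MI}
    (hE2 : MI.mem S (Real.exp (2 * b)) E2) (hE2m : MI.mem S (Real.exp (-(2 * b))) E2m) :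
    ZInv S b (k + 1) (st.step S E2 E2m) := by
  have h2 : Real.exp (-Real.log 2) = 2⁻¹ := by rw [Real.exp_neg, Real.exp_log (by norm_num)]
  constructor
  · show MI.mem S _ (MI.mul S st.P E2)
    have := MI.mem_mul hS h.hP hE2
    rw [← Real.exp_add] at this
    convert this using 2; push_cast; ring
  · show MI.mem S _ (MI.mul S st.M E2m)
    have := MI.mem_mul hS h.hM hE2m
    rw [← Real.exp_add] at this
    convert this using 2; push_cast; ring
  · show MI.mem S _ (st.Sq.mulInt 2)
    have := MI.mem_mulInt h.hSq 2
    convert this using 2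
    push_cast
    rw [show (2 * ((k : ℝ) + 1) + 1) * Real.log 2 / 2 = (2 * (k : ℝ) + 1) * Real.log 2 / 2 + Real.log 2 by ring,
      Real.exp_add, Real.exp_log (by norm_num)]
  · show MI.mem S _ (st.T.divNat 2)
    have := MI.mem_divNat h.hT (n := 2) (by norm_num)
    convert this using 2
    push_cast
    rw [show -((2 * ((k : ℝ) + 1) + 1) * Real.log 2 / 2) = -((2 * (k : ℝ) + 1) * Real.log 2 / 2) + (-Real.log 2) by ring,
      Real.exp_add, h2]
    ring

/-- One step of the loop (the forcing guard is transparent). [folklore] -/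
theorem loopB_cons (S : ℕ) (Λ eh E2 E2m : MI) (fuel k : ℕ) (sp sn : List ℤ) (SPs SNs : List (List ℤ))
    (st : ZState) (aN aP : MI) :
    loopB b r X κL S Λ eh E2 E2m (fuel + 1) k (sp :: SPs) (sn :: SNs) st aN aP
      = loopB b r X κL S Λ eh E2 E2m fuel (k + 1) SPs SNs (st.step S E2 E2m)
          (aN.add (MI.mul S (coreI S eh st.T st.Sq st.M (val2b κL b S sn (-(2 * (k : ℤ) + 1)))
            (val0 κL S sn (-(2 * (k : ℤ) + 1))) (valL κL S Λ sn (-(2 * (k : ℤ) + 1))) (valL κL S Λ sp (2 * (k : ℤ) + 1))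
            (val0 κL S sp (2 * (k : ℤ) + 1))) (wnMI r X S k)))
          (aP.add (MI.mul S (coreI S eh st.Sq st.T st.P (val2b κL b S sp (2 * (k : ℤ) + 1)) (val0 κL S sp (2 * (k : ℤ) + 1))
            (valL κL S Λ sp (2 * (k : ℤ) + 1)) (valL κL S Λ sn (-(2 * (k : ℤ) + 1))) (val0 κL S sn (-(2 * (k : ℤ) + 1))))
            (wpMI r S k))) := by
  simp only [loopB, forceMI_eq]

/-- `SPtab` unfolds by one step. [folklore] -/
theorem SPtab_succ (κL : List ℚ) (k n : ℕ) :
    SPtab κL k (n + 1) = sList κL (2 * (k : ℤ) + 1) :: SPtab κL (k + 1) n := rfl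

/-- `SNtab` unfolds by one step. [folklore] -/
theorem SNtab_succ (κL : List ℚ) (k n : ℕ) :
    SNtab κL k (n + 1) = sList κL (-(2 * (k : ℤ) + 1)) :: SNtab κL (k + 1) n := rfl

/-- **Soundness of the loop** (run on the computed tables from index `k`). [folklore] -/
theorem mem_loopB {S : ℕ} (hS : 0 < S) {Λ eh E2 E2m : MI} (hΛ : MI.mem S (Real.log 2) Λ)
    (heh : MI.mem S (Real.exp (-(Real.log 2 / 2))) eh) (hE2 : MI.mem S (Real.exp (2 * b)) E2)
    (hE2m : MI.mem S (Real.exp (-(2 * b))) E2m) (hL : Real.log 2 ≤ 2 * (b : ℝ)) (hQ : antiderivsOK r.length κL = true) :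
    ∀ (fuel k : ℕ) (st : ZState) (aN aP : MI) (xN xP : ℝ), k + fuel ≤ r.length → ZInv S b k st →
      MI.mem S xN aN → MI.mem S xP aP →
      MI.mem S (xN + ∑ j ∈ Finset.Ico k (k + fuel), (WN r X j : ℝ) * Iint κL b (-(2 * (j : ℤ) + 1)))
          (loopB b r X κL S Λ eh E2 E2m fuel k (SPtab κL k fuel) (SNtab κL k fuel) st aN aP).1 ∧
        MI.mem S (xP + ∑ i ∈ Finset.Ico k (k + fuel), (WP r i : ℝ) * Iint κL b (2 * (i : ℤ) + 1))
          (loopB b r X κL S Λ eh E2 E2m fuel k (SPtab κL k fuel) (SNtab κL k fuel) st aN aP).2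
  | 0, k, st, aN, aP, xN, xP, _, _, hN, hP => by
      simp only [loopB, add_zero, Finset.Ico_self, Finset.sum_empty]
      exact ⟨hN, hP⟩
  | fuel + 1, k, st, aN, aP, xN, xP, hk, hinv, hN, hP => by
      have hk' : k < r.length := by omega
      obtain ⟨hQp, hQn⟩ := antiderivsOK_spec hQ hk'
      -- the two new terms
      have ezb_pos : MI.mem S (expq (2 * (k : ℤ) + 1) (2 * (b : ℝ))) st.P := by
        convert hinv.hP using 2; unfold expq; push_cast; ring_nf
      have ezb_neg : MI.mem S (expq (-(2 * (k : ℤ) + 1)) (2 * (b : ℝ))) st.M := by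
        convert hinv.hM using 2; unfold expq; push_cast; ring_nf
      have ezL_pos : MI.mem S (expq (2 * (k : ℤ) + 1) (Real.log 2)) st.Sq := by
        convert hinv.hSq using 2; unfold expq; push_cast; ring_nf
      have ezL_neg : MI.mem S (expq (-(2 * (k : ℤ) + 1)) (Real.log 2)) st.T := by
        convert hinv.hT using 2; unfold expq; push_cast; ring_nf
      have ezL_neg' : MI.mem S (expq (-(-(2 * (k : ℤ) + 1))) (Real.log 2)) st.Sq := by rw [neg_neg]; exact ezL_pos
      have hQp' : antiderivOK κL (-(-(2 * (k : ℤ) + 1))) (antiderivQ κL (2 * (k : ℤ) + 1)) = true := by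
        rw [neg_neg]; exact hQp
      have vp1 := mem_val2b (κL := κL) (b := b) S (2 * (k : ℤ) + 1)
      have vpL := mem_valL (κL := κL) hS hΛ (2 * (k : ℤ) + 1)
      have vp0 := mem_val0 (κL := κL) S (2 * (k : ℤ) + 1)
      have vn1 := mem_val2b (κL := κL) (b := b) S (-(2 * (k : ℤ) + 1))
      have vnL := mem_valL (κL := κL) hS hΛ (-(2 * (k : ℤ) + 1))
      have vn0 := mem_val0 (κL := κL) S (-(2 * (k : ℤ) + 1))
      have mIn := mem_coreI (b := b) hS heh ezL_neg ezL_neg' ezb_neg hL hQn hQp' vn1 vn0 vnL vpL vp0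
      have mIp := mem_coreI (b := b) hS heh ezL_pos ezL_neg ezb_pos hL hQp hQn vp1 vp0 vpL vnL vn0
      have mWN := mem_wnMI r X S k
      have mWP := mem_wpMI r S k
      have hN' := MI.mem_add hN (MI.mem_mul hS mIn mWN)
      have hP' := MI.mem_add hP (MI.mem_mul hS mIp mWP)
      have ih := mem_loopB hS hΛ heh hE2 hE2m hL hQ fuel (k + 1) (st.step S E2 E2m) _ _ _ _ (by omega)
        (hinv.step hS hE2 hE2m) hN' hP'
      rw [SPtab_succ, SNtab_succ, loopB_cons]
      have hlt : k < (k + 1) + fuel := Nat.lt_of_lt_of_le (Nat.lt_succ_self k) (Nat.le_add_right _ _)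
      rw [show k + (fuel + 1) = (k + 1) + fuel by ring, Finset.sum_eq_sum_Ico_succ_bot hlt,
        Finset.sum_eq_sum_Ico_succ_bot hlt]
      obtain ⟨ih1, ih2⟩ := ih
      rw [add_assoc] at ih1 ih2
      rw [mul_comm (Iint κL b _) ((WN r X k : ℚ) : ℝ), mul_comm (Iint κL b _) ((WP r k : ℚ) : ℝ)] at *
      exact ⟨ih1, ih2⟩

end Summit.RiemannHypothesis.RiemannHypothesis.SoninPoly

end
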